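import Literature.IUT.HodgeArakelov.ModelCyclotomes
import Literature.AnabelianGeometry.EtaleTheta.RigidOfSetting
import HarnessLib

/-!
# Bridge B8, part 5a (companion): the interior cyclotome of the [EtTh] MODEL is `l·Δ_Θ` itself
# (proof-only; first step of GAP-LEDGER row G-w4d021-1 "`(l·Δ_Θ)(M) ≅ Ẑ(1)`" at the §1 model)

[IUTchII] Def. 1.1 (i) (kurims p. 21) attaches to a mono-theta environment the subquotient "`(l·Δ_Θ)(M)` of
`Π_Y(M)`" [claim: Mochizuki2012, status: disputed] (IUTchII §1 Def 1.1 (i), kurims p.21); for L2's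
interface `R : RigidData N l` ([EtTh] §2) the tree types it as
`ModelCyclotomes.lDeltaQuot R = (l·Δ_Θ)/thetaKer` (`ModelCyclotomes.lean`, abc-iut-L6-d6). For the [EtTh]
§1 MODEL `R := C.rigidData μ hC hS h15 L` of `X̲̲` (`RigidOfSetting.lean`, abc-iut-L2-t8: `lDeltaTheta :=`
the inverse image in `Π^tp_X̲̲` of the tempered `l·Δ_Θ ⊆ (Π^tp_X)^Θ`, `thetaKer := Ker(Π^tp_X̲̲ → (Π^tp_X)^Θ)`)
this quotient IS the tempered `l·Δ_Θ = ThetaSetting.lDeltaTheta D l` of `ThetaCyclotomes.lean`: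

* `ModelCyclotomes.nonempty_lDeltaQuot_rigidData_mulEquiv_lDeltaTheta` —
  `lDeltaQuot (C.rigidData μ hC hS h15 L) ≃* l·Δ_Θ` (first isomorphism theorem for the restricted theta
  quotient `toLDelta`, onto by `map_toTheta_Huu : θ(Π^tp_X̲̲) ∩ Δ_Θ = l·Δ_Θ`).

No hypothesis beyond the data. The sequel identifies `l·Δ_Θ` with `Ẑ` under `IsEtThOrigin` + `hYcl`
(`EtaleTheta/Discharge/Sec1DeltaThetaCommutatorQuotient.lean`, abc-iut-L2-d1, and the profinite core
`Sec1FreeTwoHeisenbergZHat.lean`, abc-iut-w5-d171), eliminating the binder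
`hZ : Nonempty (lDeltaQuot R ≃* ZHat)` of the Tate-curve forms of [IUTchII] Prop. 1.2
(`MonoThetaFromGroupsProofsTate.lean`). Seat abc-iut-L2-d1 (gen 3); proof-only, nothing of another seat
edited or restated. HONEST FRAMING: bookkeeping over a refereed source's typed interface; nothing disputed
is asserted; no side taken on [IUTchIII] Cor. 3.12. [cite: MochizukiEtTh2009, Cor 2.19(i) p.64]
-/

namespace Literature.IUT.HodgeArakelov

open Literature.AnabelianGeometry.EtaleTheta

namespace ModelCyclotomes

variable {p : ℕ} [Fact p.Prime] {D : Literature.AnabelianGeometry.EtaleTheta.ThetaSetting p}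
  {E : D.EtaleThetaData} {l : ℕ} (C : E.DoubleUnderline l) {N : ℕ+} (μ : D.CyclotomeMod l N)
  (hC : D.Compat) (hS : D.Sec2Hyps)

/-- **The interior cyclotome of the [EtTh] §1 model is the tempered `l·Δ_Θ`**: for
`R := C.rigidData μ hC hS h15 L`, `(l·Δ_Θ)(M) = lDeltaQuot R = R.lDeltaTheta/R.thetaKer` is isomorphic to
`l·Δ_Θ ⊆ (Π^tp_X)^Θ` ([EtTh] Prop. 2.12 (i) p. 45 "`l · Δ_Θ`"; [IUTchII] Def. 1.1 (i) "`(l·Δ_Θ)(M)`") — the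
restricted theta quotient `Π^tp_X̲̲ ∩ θ⁻¹(l·Δ_Θ) ↠ l·Δ_Θ` (`toLDelta`, onto by `map_toTheta_Huu`) has kernel
exactly `thetaKer`. [cite: MochizukiEtTh2009, Cor 2.19(i) p.64] -/
theorem nonempty_lDeltaQuot_rigidData_mulEquiv_lDeltaTheta
    (h15 : Literature.AnabelianGeometry.EtaleTheta.ThetaSetting.Prop15iii E hC) (L : C.CuspLabels) :
    Nonempty (lDeltaQuot (C.rigidData μ hC hS h15 L) ≃* ↥(D.lDeltaTheta l)) := by
  -- the restricted theta quotient is onto `l·Δ_Θ`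
  have hsurj : Function.Surjective C.toLDelta := by
    intro a
    have ha : (a : D.GtpTheta) ∈ C.Huu.map D.toTheta ⊓ D.DeltaTheta := by
      rw [C.map_toTheta_Huu]; exact a.2
    obtain ⟨⟨h, hh, hha⟩, -⟩ := ha
    refine ⟨⟨⟨h, hh⟩, ?_⟩, Subtype.ext hha⟩
    rw [Subgroup.mem_comap, MonoidHom.coe_comp, Function.comp_apply, Subgroup.coe_subtype, hha]
    exact a.2
  -- its kernel is `thetaKer ∩ lDeltaTheta`
  have hker : ((C.rigidData μ hC hS h15 L).thetaKer).subgroupOf (C.rigidData μ hC hS h15 L).lDeltaTheta =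
      C.toLDelta.ker := by
    ext x
    rw [Subgroup.mem_subgroupOf, MonoidHom.mem_ker, MonoidHom.mem_ker, Subtype.ext_iff]
    rfl
  exact ⟨(QuotientGroup.quotientMulEquivOfEq hker).trans
    (QuotientGroup.quotientKerEquivOfSurjective _ hsurj)⟩

end ModelCyclotomes

end Literature.IUT.HodgeArakelov
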